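import Summits.Ventures.YMGap.Thresholds.SharpPoincare
import Summits.Ventures.YMGap.Thresholds.SharpLargeN
import Summits.Ventures.YMGap.Thresholds.SharpLargeNLoops
import HarnessLib

/-!
# Venture YMGap — SZZ Corollary 1.5 (large-`N` concentration of Wilson loops) at the sharp window
# `|β| < 1/(8d)`, HYPOTHESIS-FREE

HONEST FRAMING: venture file (cell `pub-ymgap`, track (a), seat p2). The tree's `plaquette_variance_sharp`
/ `path_variance_sharp` (files `SharpLargeN`, `SharpLargeNLoops`) give Shen–Zhu–Zhu's Corollary 1.5 —
`Var_μ((1/N) Re tr W_loop) ≤ C/(N K)`, so Wilson loops concentrate as `N → ∞` at fixed 't Hooft coupling —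
at the sharp window `|β| < 1/(8d)`, CONDITIONALLY on the named Bakry–Émery fact
`shenZhuZhu_bakryEmery_transfer` (they use only its variance clause). `SharpPoincare.lean` proves that
variance clause in the kernel (`sharp_poincare_clause`); this file re-derives both corollaries WITHOUT
the named fact: for every `d ≥ 1`, `N ≥ 1`, `|β| < 1/(8d)`, every infinite-volume (tight) limit `μ` of
the torus states at tree coupling `Nβ`:
`Var_μ(Re tr U_p / N) ≤ 64/(N K)` (`plaquette_variance_sharp_free`), `≤ 128/(N²(1 - 8d|β|))`
(`plaquette_variance_sharp_free'`), and `Var_μ((1/N) Re tr Π_k U_{e_k}^{±1}) ≤ |Λ| n²/(N K)` for every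
word of `n` steps (`path_variance_sharp_free`), `K = N/2 - 4dN|β|`. WHAT IT IS NOT: not the printed
threshold's statement (SZZ print `1/(16(d-1))`; here `1/(8d)`, larger for `d ≥ 3`); no statement at
physical coupling; no mass gap.

## References

* H. Shen, R. Zhu, X. Zhu, CMP 400 (2023) 805–851, Corollary 1.5, Cor. 4.7.
-/

noncomputable section

open MeasureTheory ProbabilityTheory Matrix
open Literature.MathematicalPhysics.QuantumFieldTheory
open Literature.MathematicalPhysics.QuantumLattice
open scoped Matrix Matrix.Norms.Frobenius ContDiff

namespace Summit.Ventures.YMGap.HessianSharp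

local notation "ZdP" => Literature.MathematicalPhysics.QuantumLattice.ZdPlaquette

variable {d N : ℕ}

/-- **SZZ Cor. 1.5, plaquette case, at `|β| < 1/(8d)`, hypothesis-free**: for `d ≥ 1`, `N ≥ 1`, every
infinite-volume limit point `μ` at tree coupling `Nβ` and every plaquette `p`,
`Var_μ(Re tr U_p / N) ≤ (1/K)(64/N)`, `K = N/2 - 4dN|β|`. -/
theorem plaquette_variance_sharp_free (hd : 1 ≤ d) (hN : 1 ≤ N) {β : ℝ} (hβ : |β| < sharpThresholdSU d)
    {μ : Measure (LGConfig d (Matrix.specialUnitaryGroup (Fin N) ℂ))}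
    (hμ : μ ∈ infiniteVolumeLimitPoints (d := d) (fundamentalRep (Fin N)) ((N : ℝ) * β))
    (p : ZdP d) :
    Var[matrixCylinder (plaquetteEdges p) (plaqFun p); μ] ≤ 1 / sharpBakryEmeryConstSU N d β * (64 / N) := by
  have hV := LatticeBakryEmery.sharp_poincare_clause hd hN hβ hμ (plaquetteEdges p) (plaqFun p)
    (fun _ => 4 * (Real.sqrt N)⁻¹) (contDiff_plaqFun p) (fun _ => by positivity)
    (fun e M M' hMM' => plaqFun_lipschitz p hN e M M' hMM')
  refine hV.trans (le_of_eq ?_)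
  congr 1
  have hN0 : (0 : ℝ) < N := by exact_mod_cast hN
  rw [Finset.sum_const, Finset.card_univ, Fintype.card_coe, nsmul_eq_mul]
  have hcard : ((plaquetteEdges p).card : ℝ) = 4 := by
    have h4 : (plaquetteEdges p).card = 4 := by
      obtain ⟨x, ⟨⟨i, j⟩, hij⟩⟩ := p
      have hij' : i ≠ j := ne_of_lt hij
      have hi0 : Pi.single (M := fun _ : Fin d => ℤ) i (1 : ℤ) ≠ 0 := by
        intro h0; have := congrFun h0 i; simp at this
      have hj0 : Pi.single (M := fun _ : Fin d => ℤ) j (1 : ℤ) ≠ 0 := by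
        intro h0; have := congrFun h0 j; simp at this
      have hij0 : Pi.single (M := fun _ : Fin d => ℤ) i (1 : ℤ) ≠ Pi.single j 1 := by
        intro h0; have := congrFun h0 i; simp [hij'] at this
      simp only [plaquetteEdges]
      rw [Finset.card_insert_of_notMem, Finset.card_insert_of_notMem, Finset.card_insert_of_notMem,
        Finset.card_singleton]
      · simp [Prod.ext_iff, hij', hj0]
      · simp [Prod.ext_iff, hij'.symm, hi0, hij0]
      · simp [Prod.ext_iff, hij', hi0, hj0]
    exact_mod_cast h4
  rw [hcard, mul_pow, inv_pow, Real.sq_sqrt hN0.le]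
  field_simp
  ring

/-- The same bound in closed form: `Var_μ(Re tr U_p / N) ≤ 128/(N²(1 - 8d|β|))`, hypothesis-free; it
tends to `0` as `N → ∞` at fixed 't Hooft coupling `|β| < 1/(8d)`. -/
theorem plaquette_variance_sharp_free' (hd : 1 ≤ d) (hN : 1 ≤ N) {β : ℝ} (hβ : |β| < sharpThresholdSU d)
    {μ : Measure (LGConfig d (Matrix.specialUnitaryGroup (Fin N) ℂ))}
    (hμ : μ ∈ infiniteVolumeLimitPoints (d := d) (fundamentalRep (Fin N)) ((N : ℝ) * β))
    (p : ZdP d) :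
    Var[matrixCylinder (plaquetteEdges p) (plaqFun p); μ] ≤ 128 / ((N : ℝ) ^ 2 * (1 - 8 * d * |β|)) := by
  refine (plaquette_variance_sharp_free hd hN hβ hμ p).trans (le_of_eq ?_)
  have hN0 : (0 : ℝ) < N := by exact_mod_cast hN
  have hK : 0 < 1 - 8 * (d : ℝ) * |β| := by
    have hd' : (0 : ℝ) < 8 * d := by
      have : (1 : ℝ) ≤ d := by exact_mod_cast hd
      linarith
    have := hβ
    unfold sharpThresholdSU at this
    rw [lt_div_iff₀ hd'] at this
    nlinarith
  unfold sharpBakryEmeryConstSU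
  have : (N : ℝ) / 2 - 4 * d * N * |β| = N * (1 - 8 * d * |β|) / 2 := by ring
  rw [this]
  field_simp
  ring

/-- **SZZ Cor. 1.5 for every word / Wilson loop at `|β| < 1/(8d)`, hypothesis-free**: for `d ≥ 1`,
`N ≥ 1`, every infinite-volume limit point `μ` at tree coupling `Nβ`, every finite edge set `Λ` and
every word of `n` steps, `Var_μ((1/N) Re tr Π_k U_{e_k}^{±1}) ≤ (1/K) |Λ| n²/N`, `K = N/2 - 4dN|β|`. -/
theorem path_variance_sharp_free (hd : 1 ≤ d) (hN : 1 ≤ N) {β : ℝ} (hβ : |β| < sharpThresholdSU d)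
    {μ : Measure (LGConfig d (Matrix.specialUnitaryGroup (Fin N) ℂ))}
    (hμ : μ ∈ infiniteVolumeLimitPoints (d := d) (fundamentalRep (Fin N)) ((N : ℝ) * β))
    (Λ : Finset (Literature.MathematicalPhysics.QuantumLattice.ZdEdge d))
    (steps : List (Literature.MathematicalPhysics.QuantumLattice.ZdEdge d × Bool)) :
    Var[matrixCylinder Λ (pathFun Λ steps); μ] ≤
      1 / sharpBakryEmeryConstSU N d β * (Λ.card * (steps.length : ℝ) ^ 2 / N) := by
  have hV := LatticeBakryEmery.sharp_poincare_clause hd hN hβ hμ Λ (pathFun Λ steps)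
    (fun _ => steps.length * (Real.sqrt N)⁻¹) (contDiff_pathFun Λ steps)
    (fun _ => by positivity) (fun e M M' hMM' => pathFun_lipschitz Λ steps hN e M M' hMM')
  refine hV.trans (le_of_eq ?_)
  congr 1
  have hN0 : (0 : ℝ) < N := by exact_mod_cast hN
  rw [Finset.sum_const, Finset.card_univ, Fintype.card_coe, nsmul_eq_mul, mul_pow, inv_pow,
    Real.sq_sqrt hN0.le]
  field_simp

end Summit.Ventures.YMGap.HessianSharp
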